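import Mathlib
import Summits.CriticalPhenomena.PercolationContinuityZ3.Theorems.PercNearOneGluingAdditiveGluingOneBond
import Literature.Probability.LatticeModels.ProdBernoulliCoupling
import Literature.Probability.Percolation.PercolationEvents
import HarnessLib

/-!
# Kozma–Nitzan Lemma 13: the shortening step implies Conjecture 1

Stub `stub_lemma13` of line `kn_shortening_induction` (crux strategist s1, 2026-08-16) for the crux
`PercNearOneGluing.NearOneGluing` (item stmt-CriticalPhenomena-4574 = Kozma–Nitzan Conjecture 3 over all finite
weighted graphs).

Setting: weights `w : Sym2 (Fin n) → [0,1]`, `μ_w = prodBernoulli w` on bond configurations of the complete graph on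
`Fin n` (weight `0` = absent pair), `P_w(x ↔ y) = μ_w(openConn x y)`.

The HYPOTHESIS is the registered kernel `stub_shorteningStep` verbatim (Kozma–Nitzan Conjecture 6,
arXiv:2401.12397 p.34, with the induction hypothesis displayed): for `v ∉ A`, `x ≠ v`, `w s(v,x) = 0`, a minimiser
`a₀ ∈ A` of `P_w(· ↔ b)` and Conjecture 1 known for every weight function supported inside the support of `w`,
Conjecture 1's inequality holds at the glued source in `w[s(v,x) ↦ 1]` against the OLD minimiser `a₀`.
The CONCLUSION is Kozma–Nitzan Conjecture 1 (p.3) in min-free typing.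

Proof (KN Lemma 13, p.34): strong induction on the number of positive pairs.  If `o ∈ A` or `o` has no positive
pair the claim is immediate (`lemma13_exists_open_pair`: an open `o–a` path starts with an open pair at `o`).
Otherwise pick `x` with `w s(o,x) ≠ 0`, let `H₀ := w[s(o,x) ↦ 0]` (fewer positive pairs) and `H₁ := w[s(o,x) ↦ 1]`,
and let `a₀` minimise `P_{H₀}(· ↔ b)` on `A`.  Induction gives `Y₀ Z₀ ≤ X₀` (`X = P(o↔b)`, `Y = P(o↔A)`,
`Z = P(a₀↔b)`), the step gives `Y₁ Z₁ ≤ X₁`, the one-bond decomposition (`stub_oneBondDecomp_k15`) writes each of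
`X, Y, Z` at `w` as `(1−p)·(·)₀ + p·(·)₁` with `p = w s(o,x)`, monotonicity in the weights
(`prodBernoulli_real_mono_of_isUpperSet`) gives `Y₀ ≤ Y₁`, `Z₀ ≤ Z₁`, and the algebra
`X − YZ = (1−p)(X₀ − Y₀Z₀) + p(X₁ − Y₁Z₁) + p(1−p)(Y₁−Y₀)(Z₁−Z₀) ≥ 0` (`lemma13_algebra`) concludes, since
`t ≤ P_w(a₀ ↔ b) = Z`.
-/

namespace Summit.CriticalPhenomena.PercolationContinuityZ3.Theorems

open MeasureTheory Set Literature.Probability.LatticeModels Literature.Probability.Percolation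
open scoped Classical BigOperators

section Lemma13

variable {n : ℕ}

/-- An open path from `o` to a different vertex `a` begins with an open pair `s(o, x)`, `x ≠ o`. [folklore] -/
theorem lemma13_exists_open_pair {ω : BondConfig (Fin n)} {o a : Fin n} (hoa : o ≠ a)
    (h : ω ∈ openConn o a) : ∃ x : Fin n, x ≠ o ∧ s(o, x) ∈ ω := by
  obtain ⟨p⟩ := (h : (openGraph ω).Reachable o a)
  cases p with
  | nil => exact absurd rfl hoa
  | cons hadj _ =>
    have h' := (openGraph_adj ω _ _).1 hadj
    exact ⟨_, fun hx => h'.2 hx.symm, h'.1⟩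

/-- If every pair at `o` has weight `0` and `o ∉ A`, then `P(o ↔ A) = 0`. [folklore] -/
theorem lemma13_reach_eq_zero (w : Sym2 (Fin n) → unitInterval) (A : Finset (Fin n)) {o : Fin n}
    (hoA : o ∉ A) (hiso : ∀ x : Fin n, x ≠ o → w s(o, x) = 0) :
    (prodBernoulli w).real (⋃ a ∈ A, openConn o a) = 0 := by
  set F : Finset (Sym2 (Fin n)) := (Finset.univ.filter fun x : Fin n => x ≠ o).image fun x => s(o, x)
    with hF
  have hsub : (⋃ a ∈ A, openConn o a : Set (BondConfig (Fin n))) ⊆ {ω | ∃ i ∈ F, i ∈ ω} := by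
    intro ω hω
    simp only [mem_iUnion, exists_prop] at hω
    obtain ⟨a, ha, h⟩ := hω
    have hoa : o ≠ a := fun h' => hoA (h' ▸ ha)
    obtain ⟨x, hxo, hx⟩ := lemma13_exists_open_pair hoa h
    exact ⟨s(o, x), Finset.mem_image.2 ⟨x, by simp [hxo], rfl⟩, hx⟩
  have hle : (prodBernoulli w).real (⋃ a ∈ A, openConn o a) ≤ ∑ i ∈ F, (w i : ℝ) :=
    (measureReal_mono hsub).trans (prodBernoulli_real_exists_mem_le_sum w F)
  have hsum : ∑ i ∈ F, (w i : ℝ) = 0 := by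
    refine Finset.sum_eq_zero fun i hi => ?_
    obtain ⟨x, hx, rfl⟩ := Finset.mem_image.1 hi
    simp only [Finset.mem_filter, Finset.mem_univ, true_and] at hx
    simp [hiso x hx]
  exact le_antisymm (hle.trans hsum.le) measureReal_nonneg

/-- The concavity algebra of KN Lemma 13: with `X = (1−p)X₀ + pX₁` etc., `Y₀Z₀ ≤ X₀`, `Y₁Z₁ ≤ X₁`,
`Y₀ ≤ Y₁`, `Z₀ ≤ Z₁`, `0 ≤ Y₀`, `0 ≤ p ≤ 1` and `t ≤ Z` give `Y·t ≤ X`. [folklore] -/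
theorem lemma13_algebra {p X₀ X₁ Y₀ Y₁ Z₀ Z₁ t : ℝ} (hp0 : 0 ≤ p) (hp1 : p ≤ 1)
    (h0 : Y₀ * Z₀ ≤ X₀) (h1 : Y₁ * Z₁ ≤ X₁) (hY : Y₀ ≤ Y₁) (hZ : Z₀ ≤ Z₁) (hY0 : 0 ≤ Y₀)
    (ht : t ≤ (1 - p) * Z₀ + p * Z₁) :
    ((1 - p) * Y₀ + p * Y₁) * t ≤ (1 - p) * X₀ + p * X₁ := by
  have hq : 0 ≤ 1 - p := sub_nonneg.2 hp1
  have hYnn : 0 ≤ (1 - p) * Y₀ + p * Y₁ :=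
    add_nonneg (mul_nonneg hq hY0) (mul_nonneg hp0 (hY0.trans hY))
  have h3 : 0 ≤ p * (1 - p) * ((Y₁ - Y₀) * (Z₁ - Z₀)) :=
    mul_nonneg (mul_nonneg hp0 hq) (mul_nonneg (sub_nonneg.2 hY) (sub_nonneg.2 hZ))
  have h4 : 0 ≤ (1 - p) * (X₀ - Y₀ * Z₀) := mul_nonneg hq (sub_nonneg.2 h0)
  have h5 : 0 ≤ p * (X₁ - Y₁ * Z₁) := mul_nonneg hp0 (sub_nonneg.2 h1)
  have e : (1 - p) * X₀ + p * X₁ - ((1 - p) * Y₀ + p * Y₁) * ((1 - p) * Z₀ + p * Z₁) =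
      (1 - p) * (X₀ - Y₀ * Z₀) + p * (X₁ - Y₁ * Z₁) + p * (1 - p) * ((Y₁ - Y₀) * (Z₁ - Z₀)) := by
    ring
  have key : ((1 - p) * Y₀ + p * Y₁) * ((1 - p) * Z₀ + p * Z₁) ≤ (1 - p) * X₀ + p * X₁ := by
    linarith [e, h3, h4, h5]
  exact (mul_le_mul_of_nonneg_left ht hYnn).trans key

/-- **Kozma–Nitzan Lemma 13: the shortening step (Conjecture 6 with the induction hypothesis displayed) implies
Conjecture 1** (registered stub `stub_lemma13` of the line `Cruxes/NearOneGluing/Lines/kn_shortening_induction.lean`,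
verbatim signature).  Strong induction on the number of positive pairs, one-bond decomposition and concavity, as in
the module docstring. [cite: KozmaNitzan2024, §5.3 Lemma 13 p. 34] -/
theorem stub_lemma13 :
    (∀ (n : ℕ) (w : Sym2 (Fin n) → unitInterval) (A : Finset (Fin n)) (b v x a₀ : Fin n),
      v ∉ A → v ≠ x → w s(v, x) = 0 → a₀ ∈ A →
      (∀ a ∈ A, (prodBernoulli w).real (openConn a₀ b) ≤ (prodBernoulli w).real (openConn a b)) →
      (∀ w' : Sym2 (Fin n) → unitInterval, (∀ e, w e = 0 → w' e = 0) →
        ∀ (A' : Finset (Fin n)) (o' b' : Fin n) (t : ℝ),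
          (∀ a ∈ A', t ≤ (prodBernoulli w').real (openConn a b')) →
          (prodBernoulli w').real (⋃ a ∈ A', openConn o' a) * t ≤ (prodBernoulli w').real (openConn o' b')) →
      (prodBernoulli (Function.update w s(v, x) 1)).real (⋃ a ∈ A, openConn v a) *
          (prodBernoulli (Function.update w s(v, x) 1)).real (openConn a₀ b) ≤
        (prodBernoulli (Function.update w s(v, x) 1)).real (openConn v b)) →
    ∀ (n : ℕ) (w : Sym2 (Fin n) → unitInterval) (A : Finset (Fin n)) (o b : Fin n) (t : ℝ),
      (∀ a ∈ A, t ≤ (prodBernoulli w).real (openConn a b)) →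
      (prodBernoulli w).real (⋃ a ∈ A, openConn o a) * t ≤ (prodBernoulli w).real (openConn o b) := by
  intro hStep n
  -- strong induction on the number of positive pairs
  suffices H : ∀ k : ℕ, ∀ w : Sym2 (Fin n) → unitInterval,
      (Finset.univ.filter fun e => w e ≠ 0).card = k →
      ∀ (A : Finset (Fin n)) (o b : Fin n) (t : ℝ),
        (∀ a ∈ A, t ≤ (prodBernoulli w).real (openConn a b)) →
        (prodBernoulli w).real (⋃ a ∈ A, openConn o a) * t ≤ (prodBernoulli w).real (openConn o b) by
    intro w A o b t ht
    exact H _ w rfl A o b t ht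
  intro k
  induction k using Nat.strong_induction_on with
  | _ k ih =>
  intro w hk A o b t ht
  have hY0 : 0 ≤ (prodBernoulli w).real (⋃ a ∈ A, openConn o a) := measureReal_nonneg
  have hY1 : (prodBernoulli w).real (⋃ a ∈ A, openConn o a) ≤ 1 := measureReal_le_one
  have hX0 : 0 ≤ (prodBernoulli w).real (openConn o b) := measureReal_nonneg
  -- case `o ∈ A`: `t ≤ P(o ↔ b)` is a hypothesis
  by_cases hoA : o ∈ A
  · have hob := ht o hoA
    by_cases ht0 : 0 ≤ t
    · calc (prodBernoulli w).real (⋃ a ∈ A, openConn o a) * t ≤ 1 * t :=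
            mul_le_mul_of_nonneg_right hY1 ht0
        _ = t := one_mul t
        _ ≤ _ := hob
    · push Not at ht0
      exact (mul_nonpos_iff.2 (Or.inl ⟨hY0, ht0.le⟩)).trans hX0
  -- case: every pair at `o` has weight `0`
  by_cases hiso : ∀ x : Fin n, x ≠ o → w s(o, x) = 0
  · rw [lemma13_reach_eq_zero w A hoA hiso, zero_mul]
    exact hX0
  push Not at hiso
  obtain ⟨x, hxo, hwx⟩ := hiso
  have hox : o ≠ x := fun h => hxo h.symm
  -- the two endpoint weight functions
  have hupd0 : Function.update w s(o, x) 0 s(o, x) = 0 := Function.update_self ..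
  -- the support of `w[e ↦ 0]` is strictly smaller
  have hcard : (Finset.univ.filter fun e => Function.update w s(o, x) 0 e ≠ 0).card < k := by
    rw [← hk]
    refine Finset.card_lt_card ⟨?_, ?_⟩
    · intro e he
      simp only [Finset.mem_filter, Finset.mem_univ, true_and, Function.update_apply] at he ⊢
      split_ifs at he with h
      · exact absurd rfl he
      · exact he
    · intro hsub
      have := hsub (show s(o, x) ∈ Finset.univ.filter (fun e => w e ≠ 0) by simp [hwx])
      simp at this
  -- induction hypothesis for every weight function supported inside the support of `w[e ↦ 0]`
  have hIH : ∀ w' : Sym2 (Fin n) → unitInterval, (∀ e, Function.update w s(o, x) 0 e = 0 → w' e = 0) →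
      ∀ (A' : Finset (Fin n)) (o' b' : Fin n) (t' : ℝ),
        (∀ a ∈ A', t' ≤ (prodBernoulli w').real (openConn a b')) →
        (prodBernoulli w').real (⋃ a ∈ A', openConn o' a) * t' ≤ (prodBernoulli w').real (openConn o' b') := by
    intro w' hw' A' o' b' t' ht'
    refine ih _ ?_ w' rfl A' o' b' t' ht'
    refine lt_of_le_of_lt (Finset.card_le_card ?_) hcard
    intro e he
    simp only [Finset.mem_filter, Finset.mem_univ, true_and] at he ⊢
    exact fun h0 => he (hw' e h0)
  -- `A` nonempty (else trivial) and the minimiser `a₀` for `w[e ↦ 0]`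
  rcases A.eq_empty_or_nonempty with hA | hA
  · subst hA
    simp
  obtain ⟨a₀, ha₀, hmin⟩ :=
    A.exists_min_image (fun a => (prodBernoulli (Function.update w s(o, x) 0)).real (openConn a b)) hA
  -- the step at `w[e ↦ 0]`: Conjecture 1's inequality for `w[e ↦ 1]` against `a₀`
  have hstep := hStep n (Function.update w s(o, x) 0) A b o x a₀ hoA hox hupd0 ha₀ hmin hIH
  simp only [Function.update_idem] at hstep
  -- induction at `w[e ↦ 0]` itself with `t := Z₀`
  have h0 := hIH (Function.update w s(o, x) 0) (fun e h => h) A o b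
    ((prodBernoulli (Function.update w s(o, x) 0)).real (openConn a₀ b)) hmin
  -- one-bond decompositions of `X, Y, Z`
  have hX := stub_oneBondDecomp_k15 n w s(o, x) (openConn o b)
  have hY := stub_oneBondDecomp_k15 n w s(o, x) (⋃ a ∈ A, openConn o a)
  have hZ := stub_oneBondDecomp_k15 n w s(o, x) (openConn a₀ b)
  -- monotonicity `Y₀ ≤ Y₁`, `Z₀ ≤ Z₁`
  have hle : Function.update w s(o, x) 0 ≤ Function.update w s(o, x) 1 := by
    intro e
    by_cases he : e = s(o, x)
    · subst he; simp
    · simp [he]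
  have hUA : IsUpperSet (⋃ a ∈ A, openConn o a : Set (BondConfig (Fin n))) := by
    intro ω ω' hle' hω
    simp only [mem_iUnion, exists_prop] at hω ⊢
    obtain ⟨a, ha, h⟩ := hω
    exact ⟨a, ha, isUpperSet_openConn o a hle' h⟩
  have hYm := prodBernoulli_real_mono_of_isUpperSet hle hUA (Set.toFinite _).measurableSet
  have hZm := prodBernoulli_real_mono_of_isUpperSet hle (isUpperSet_openConn a₀ b)
    (Set.toFinite _).measurableSet
  have hY00 : 0 ≤ (prodBernoulli (Function.update w s(o, x) 0)).real (⋃ a ∈ A, openConn o a) :=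
    measureReal_nonneg
  have hp0 : 0 ≤ (w s(o, x) : ℝ) := (w s(o, x)).2.1
  have hp1 : (w s(o, x) : ℝ) ≤ 1 := (w s(o, x)).2.2
  have ht' := ht a₀ ha₀
  rw [hZ] at ht'
  rw [hX, hY]
  exact lemma13_algebra hp0 hp1 h0 hstep hYm hZm hY00 ht'

end Lemma13

end Summit.CriticalPhenomena.PercolationContinuityZ3.Theorems
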